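import Mathlib.Tactic.Linarith
import Mathlib.Tactic.Ring
import Mathlib.Tactic.NormNum
import Mathlib.Tactic.IntervalCases
import Mathlib.Tactic.NoncommRing
import Mathlib.Algebra.BigOperators.Group.Finset.Basic
import Mathlib.Algebra.Order.BigOperators.Group.Finset
import HarnessLib

/-!
# The (0,1) cell of the ι-window, EXISTENCE side, XIX: the row (R16-a) of the 2Θ-habitat is DEAD on a general fourfold —
# the two-torsion lemma, the rank formula, the uniform plane lemma; arithmetic skeleton of `H2-EXISTENCE-SIDE-19.md`

Family `hodge`, b2b cell `hweil`, `Summits/HodgeConjecture/HodgeConjecture/Theorems` (helper of item stmt-HodgeConjecture-2524, the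
Weil-sixfold rung the H2 test serves). Companion to `WeilTypeLadderH2TwoThetaHabitat.lean` ([XVI]),
`WeilTypeLadderH2AbelPrymEigenbundles.lean` ([XVII]) and `WeilTypeLadderH2TorsionJunk.lean` ([XVIII]).

Setting (notation of [XVI]–[XVIII]). `(A, Θ)` a general principally polarised abelian fourfold (`Θ` smooth, `NS = ℤθ`), realised as the
Prym variety of a double cover `f : C̃ → C` (étale, `g(C) = 5`; or ramified in two points, `g(C) = 4`), `ψ : C̃ → A` the Abel–Prym map,
`Z = c + ψ(C̃)` (`c ∈ A[2]`) an `ι`-invariant Abel–Prym carrier, `a ∈ A° = A ∖ (A[2] ∪ N_tan ∪ ⋃_{x ∈ A[2]} (Θ + x))`, `S_a = Θ_a ∩ Θ_{−a}`,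
`n_S(a, Z) = length(Z ∩ S_a) = 2k`, `Λ_a = H⁰(𝓘_{S_a}(2Θ)) = ⟨θ_aθ_{−a}, W_v⟩ ≅ k ⊕ T₀A`, `ρ(a, Z) = rank(res_Z|Λ_a)`, `K = ker(res_Z|Λ_a)`,
`Λ_a^{(z)} = {(λ, v) : v ∈ T_zS_a}` the members singular at `z ∈ S_a` ([XVI] 1.4 (a)).

THEOREM A (report §1, the two-torsion lemma). `ψ^* ∘ φ_Θ = −ι_P : A → Pic⁰(C̃)` ([La23] Cor. 4.5.2 with `ι_P^*Θ̃ ≡ 2Ξ`, `N_P = 1 − σ̃`,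
`(1 − σ̃)² = 2(1 − σ̃)`), so `Pic⁰(A) → Pic⁰(C̃)` is injective; if `Z ⊄ Θ_{±a}` and the degree-`8` divisors `ν^*Θ_a`, `ν^*Θ_{−a}` on `C̃`
coincide then `ψ^*P_{φ(2a)}` is trivial and `2a = 0`. Hence `n_S(a, Z) ≤ 6` for every `a ∈ A°`: the cell (c3) of [XVIII] (`n_S = 8`;
PROPOSITION 6's `a_B` are exactly the `2⁸ = 256` two-torsion points, where `S_a = Θ_a` is a divisor and `Λ_a` is a line) is VOID.
THEOREM B (report §2, rank formula and uniform plane lemma; étale carriers, nodal ones given (F) = [XVII] THM 3's `M₊ ≅ ω_C(x + y)`).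
With `E_a = 𝒪_{C̃}(ν^*Θ_a)` (`h⁰ = 1` on `A° ∖ V_Z`; `a ↦ E_a` a torsor isomorphism by THEOREM A) and `G : a ↦ f_*D_{E_a} ∈ |Nm E_a| ≅ ℙ⁴`:
`ρ = 1 + rank dG_E`, `rank dG_E = 4 − dim(T_EP ∩ ker d(f_*)_{D_E})`, `dim ker d(f_*)_{D_E} = Σ_orbits min(a_p, b_p) = k` (the symmetrisation
map `(P, Q) ↦ PQ` on monic polynomials has differential `(δP, δQ) ↦ u^bδP + u^aδQ`, kernel of dimension `min(a, b)`); the RANK LEMMA's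
upper bound `ρ ≤ 5 − k` (`k ≤ 3`) meets the lower bound `ρ ≥ 1 + (4 − k)`: `ρ(a, Z) = 5 − n_S/2` EXACTLY, `K ≅ ker d(f_*)_{D_E} = ⊕_p V_p`,
and since `T_zΘ_{±a}` = 'the point `y` resp. `σy` stays in `D_E`' cuts the local kernel `V_p` (`p = f(y)`) in codimension exactly one:
`dim(K ∩ Λ^{(z)}) = k − 1`, `dim(K ∩ Λ^{(z)} ∩ Λ^{(z′)}) = k − 2`, three orbits `k − 3` — for EVERY intersection pattern. So the members of
`ℙ(Λ_a)` through `Z` singular at `j` prescribed `ι`-orbits of `Z ∩ S_a` form a `ℙ^{k−j−1}`: a LINE for `(k, j) = (3, 1)`, a POINT for `(3, 2)`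
and `(2, 1)`, nothing otherwise. PROPOSITION C (report §3): `δ_p ≡ 1` at every node of `D` on `Z` (so `n_S + n_Γ = 8 + ν`), and the
H2-numerical configurations with nodes on the carrier are exactly six types FH(2,1,2), FH(3,1,0), FH(3,2,2), SH(2,1,0), SH(3,1,2), SH(3,2,2)
(`(k, j, ℓ)`, `ℓ` = junk length), each lying on an irreducible flat effective family of simple `ι`-sheaves of dimension `≥ 2 + d′ ≥ 3`
(base `{n_S = 2k}` of dimension `≥ 4 + d′ − k` via the zero locus of a section of a rank-`2k` bundle on the `(a, Z, B)`-incidence, members `ℙ^{k−j−1}`, junk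
at an on-carrier node in `ℙ^{μ(N)−1}` with `2 ≤ μ(N) ≤ 4`, LEMMA Q) — THEOREM D: by [XVIII] THEOREM 4 / the family mechanism every one of them
has `e₁^ι ≥ 2`. THE ROW (R16-a) IS DEAD on a general fourfold (étale carriers: thm; nodal carriers: thm given (F)); the cells (c1), (c2),
(c3) and '8.3 (e)' of [XVIII] are VOID or DEAD; the residual of the 2Θ-habitat on a general `A` is (R16-b), (R16-d), (R16-f), nest (N16-M);
(R16-c) special `A`.

Def-free, fully proved ELEMENTARY statements (integer bookkeeping and two small algebraic identities); the geometry is in the docstrings and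
the report `run/shared/lean/b2b/hodge-weil/b2b-hweil-pv3-g26/H2-EXISTENCE-SIDE-19.md`. HONEST FRAMING: structure / census results about one
cell of the ladder's H2 test on the existence side; no case of the Hodge conjecture is proved; nothing here is a rung; no statement of
[Markman 2025] is used; nothing depends on (LP), (8.3.3), (GP17), (GP18) or (S). 0 unconditional rungs above the floor.
-/

set_option linter.dupNamespace false

open Finset

namespace Summit.HodgeConjecture.HodgeConjecture.WeilTypeLadder

section H2UniformPlane

/-- LEMMA AP (report 1.1), the algebraic identity behind `ψ^* ∘ φ_Ξ = −ι_P`: with `N : J̃ → P` the norm map (`ι_P N = 1 − σ̃`,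
[La23] Lemma 5.3.11) and `ι_P^*Θ̃ ≡ 2Ξ`, one has `2·(N̂ φ_Ξ N) = (1 − σ̃)^ φ_Θ̃ (1 − σ̃) = φ_Θ̃ (1 − σ̃)² = 2·φ_Θ̃(1 − σ̃)` because
`(1 − σ)² = 2(1 − σ)` for an involution `σ`; `Hom(J̃, Ĵ̃)` is torsion-free, so `N̂ φ_Ξ N = φ_Θ̃ ι_P N`, and [La23] Cor. 4.5.2
(`ψ^* = −φ_Θ̃^{−1} N̂`) gives `ψ^* φ_Ξ = −ι_P`, injective. Recorded: the involution identity in any ring, and cancellation of `2`. -/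
theorem abel_prym_pullback_identity {R : Type*} [Ring R] (σ : R) (hσ : σ * σ = 1) :
    (1 - σ) * (1 - σ) = 2 * (1 - σ) ∧ (∀ x y : ℤ, 2 * x = 2 * y → x = y) := by
  refine ⟨?_, fun x y h => by omega⟩
  have h1 : (1 - σ) * (1 - σ) = 1 - 2 * σ + σ * σ := by noncomm_ring
  rw [h1, hσ]; noncomm_ring

/-- THEOREM A (report 1.2), the divisor step: two effective divisors of the same degree on a smooth curve whose scheme-theoretic
intersection (`Σ_y min(m_y, n_y)`) has full length coincide. Applied to `ν^*Θ_a`, `ν^*Θ_{−a}` (degree `8` on `C̃`): `n_S(a, Z) = 8` forces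
`ν^*Θ_a = ν^*Θ_{−a}`, hence `ψ^*P_{φ(2a)} ≅ 𝒪`, hence `2a = 0` by LEMMA AP — impossible for `a ∈ A°`. Recorded: the combinatorial step
for finitely supported multiplicity functions. -/
theorem full_length_gcd_forces_equality {α : Type*} (s : Finset α) (m n : α → ℕ)
    (hm : ∑ i ∈ s, min (m i) (n i) = ∑ i ∈ s, m i) (hn : ∑ i ∈ s, min (m i) (n i) = ∑ i ∈ s, n i) :
    ∀ i ∈ s, m i = n i := by
  have h1 : ∀ i ∈ s, min (m i) (n i) = m i :=
    (Finset.sum_eq_sum_iff_of_le (fun i _ => Nat.min_le_left (m i) (n i))).mp hm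
  have h2 : ∀ i ∈ s, min (m i) (n i) = n i :=
    (Finset.sum_eq_sum_iff_of_le (fun i _ => Nat.min_le_right (m i) (n i))).mp hn
  intro i hi
  rw [← h1 i hi, h2 i hi]

/-- THEOREM A (report 1.3), bookkeeping: `n_S = 2k` is even and `≤ Θ·Z = 8`; `n_S = 8` is excluded on `A°`, so `k ∈ {0, 1, 2, 3}` — the
cell (c3) of [XVIII] 9.2/10.2 (which needs `n_S = 8`, i.e. `k = 4`) is VOID; the `2⁸ = 256` 'admissible odd theta-characteristics' of
[XVIII] PROPOSITION 6 (σ^*-fixed points `f^*B` of the torsor `P⁻`) correspond exactly to the `2^{2·4} = 256` two-torsion points of `A`,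
where `Θ_a = Θ_{−a}`, `S_a` is a divisor and `Λ_a = H⁰(𝓘_{Θ_a}(2Θ))` is a line. Recorded: the arithmetic. -/
theorem two_torsion_bookkeeping (nS : ℕ) (heven : nS % 2 = 0) (hle : nS ≤ 8) (hne : nS ≠ 8) :
    nS / 2 ≤ 3 ∧ (nS = 0 ∨ nS = 2 ∨ nS = 4 ∨ nS = 6) ∧ (2 : ℕ) ^ 8 = 2 ^ (2 * 4) ∧ (2 : ℕ) ^ (2 * 4) = 256 ∧
    (2 : ℕ) ^ 4 * (2 ^ 5 - 1) = 496 := by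
  refine ⟨by omega, by omega, by norm_num, by norm_num, by norm_num⟩

/-- THEOREM B (a) (report 2.2), the RANK FORMULA: `ρ = 1 + rank dG_E` with `rank dG_E = 4 − dim(T_EP ∩ V)`, `V = ker d(f_*)_{D_E}` of
dimension `k = n_S/2`, so `rank dG_E ≥ 4 − k` and `ρ ≥ 5 − k`; the RANK LEMMA ([XVIII] 9.1) gives `ρ ≤ 5 − k` for `k ≤ 3` (`C`
non-hyperelliptic, non-trigonal; nodal carriers given (F)). Hence `ρ = 5 − k`, `dim(T_EP ∩ V) = k = dim V`, i.e. `V ⊂ T_EP` and `K ≅ V`.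
Recorded: the squeeze. -/
theorem rank_formula (k r i : ℤ) (hk0 : 0 ≤ k) (hk : k ≤ 3) (_hi : 0 ≤ i) (hik : i ≤ k)
    (hrank : r = 4 - i) (hupper : 1 + r ≤ 5 - k) :
    r = 4 - k ∧ 1 + r = 5 - k ∧ i = k ∧ 5 - (5 - k) = k ∧ (1 : ℤ) ≤ 5 - k := by
  refine ⟨by omega, by omega, by omega, by omega, by omega⟩

/-- THEOREM B (b) (report 2.3), the LOCAL KERNEL: near a σ-pair `(y, σy)` of multiplicities `(a, b)` in `D_E` the map `f_* : C̃_8 → C_8`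
is the symmetrisation `(P, Q) ↦ PQ` of monic polynomials of degrees `a`, `b` in a common coordinate; its differential at `(u^a, u^b)` is
`(δP, δQ) ↦ u^b δP + u^a δQ` (`deg δP < a`, `deg δQ < b`), with kernel `{(−u^{a−b}R, R) : deg R < b}` (for `a ≥ b`) of dimension
`min(a, b)` and image of dimension `max(a, b)`; the conditions '`y` stays in `D`' (`δP(0) = 0`) and '`σy` stays in `D`' (`δQ(0) = 0`)
cut the kernel in `{R : R(0) = 0}`, of dimension `min(a, b) − 1` — ONE condition, whatever `(a, b)`. Summing over the `σ`-orbits of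
`Z ∩ S_a` (`Σ min = k`): `dim ker d(f_*) = k`. Recorded: the dimension bookkeeping (`uniform19.py` §B verifies the linear algebra for all
`a + b ≤ 9`). -/
theorem local_kernel_dims (a b : ℕ) (ha : 1 ≤ a) (hb : 1 ≤ b) :
    a + b - min a b = max a b ∧ min a b - 1 + 1 = min a b ∧ (min a b - 1 < min a b) ∧
    (a = 1 → b = 1 → min a b - 1 = 0) := by
  refine ⟨by omega, by omega, by omega, by omega⟩

/-- THEOREM B (c) (report 2.4), the UNIFORM PLANE LEMMA: `K ≅ V = ⊕_p V_p` (orbits `p` of `Z ∩ S_a`, `dim V_p = μ_p`, `Σ μ_p = k`) and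
`K ∩ Λ^{(z)} ≅ V ∩ T_zΘ_a ∩ T_zΘ_{−a}` with the two tangent hyperplanes touching only the block `V_{p(z)}`, in codimension one there; so
`dim(K ∩ Λ^{(z)}) = (k − μ) + (μ − 1) = k − 1`, for two distinct orbits `(k − μ − μ′) + (μ − 1) + (μ′ − 1) = k − 2`, for three `k − 3` —
INDEPENDENT of the pattern `(μ, μ′, …)`. The members of `ℙ(Λ_a)` containing `Z` and singular at `j` prescribed orbits therefore form a
`ℙ^{k−j−1}`. Recorded: the arithmetic. -/
theorem uniform_plane (k μ μ' μ'' : ℤ) (_h1 : 1 ≤ μ) (_h2 : 1 ≤ μ') (_h3 : 1 ≤ μ'') :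
    (k - μ) + (μ - 1) = k - 1 ∧ (k - μ - μ') + (μ - 1) + (μ' - 1) = k - 2 ∧
    (k - μ - μ' - μ'') + (μ - 1) + (μ' - 1) + (μ'' - 1) = k - 3 := by
  refine ⟨by omega, by omega, by omega⟩

/-- THEOREM B (d) (report 2.5), the member spaces: with `k ≤ 3` (THEOREM A) the members through `Z` form `ℙ^{k−1}`, those singular at one
prescribed orbit `ℙ^{k−2}` (non-empty iff `k ≥ 2`: a point for `k = 2`, a LINE for `k = 3`), at two prescribed orbits `ℙ^{k−3}` (a point,
iff `k = 3`), at three never. In particular: a junk-free first-hull (R16-a) candidate (`n_S = 6`, one nodal pair) moves in a `ℙ¹` over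
EVERY point of `{n_S = 6}` — no rank-jump cell (c1), no tangential exception (c2); and [XVIII] 5.4's expected fibre dimension `2 − ρ = k − 3`
is exceeded by exactly one everywhere. Recorded: the case list. -/
theorem member_space_dims (k : ℕ) (hk : k ≤ 3) :
    ((1 : ℤ) ≤ (k : ℤ) - 1 - 1 + 1 ↔ 2 ≤ k) ∧ ((0 : ℤ) ≤ (k : ℤ) - 2 - 1 ↔ k = 3) ∧ ((k : ℤ) - 3 - 1 < 0) ∧
    ((k : ℤ) - 2 - ((k : ℤ) - 3) = 1) ∧ (k = 3 → (k : ℤ) - 1 - 1 = 1) ∧ (k = 2 → (k : ℤ) - 1 - 1 = 0) := by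
  refine ⟨by omega, by omega, by omega, by omega, by omega, by omega⟩

/-- PROPOSITION C (a) (report 3.1): [XVIII] 5.2's node excess `δ_p = min(o_x, o_y) + min(o_x, o_z) − o_x` (branch orders of the exact node
coordinates `x, y, z, w` along `Z`, `o_x + o_w = o_y + o_z`) is IDENTICALLY `1`, because `Z` is smooth at the node with non-zero tangent
vector, i.e. `min(o_x, o_y, o_z, o_w) = 1` ([XVIII] 5.1 (d)): if `o_x = 1` both minima are `1`; if `o_y = 1` or `o_z = 1` the sum is
`1 + (≤ o_x)`, forced to `1` by `δ_p ≥ 1`'s proof; if `o_w = 1` then `o_y + o_z = o_x + 1` with `o_y, o_z ≥ 2` impossible unless they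
are `< o_x`, giving `o_y + o_z − o_x = 1`. Hence `n_S + n_Γ = 8 + ν` with `ν` the NUMBER of nodes of `D` on `Z`; the sub-case
'one pair with `δ_p = 2`' of [XVIII] 9.2 (c3) does not exist. Recorded: the statement, by exhaustion of the four cases. -/
theorem node_excess_eq_one (ox oy oz ow : ℕ) (hx : 1 ≤ ox) (hy : 1 ≤ oy) (hz : 1 ≤ oz) (hw : 1 ≤ ow)
    (hrel : ox + ow = oy + oz) (hmin : ox = 1 ∨ oy = 1 ∨ oz = 1 ∨ ow = 1) :
    min ox oy + min ox oz = ox + 1 := by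
  rcases hmin with h | h | h | h <;> subst h <;> omega

/-- PROPOSITION C (b) (report 3.2), the TYPE LIST. A configuration of [XVI] COR A2's normal form with `ν = 2j ≥ 2` nodes of `D` on the
carrier (`j` orbits), `n_S = 2k` (`k ≤ 3` by THEOREM A), junk of length `ℓ`: `n_Γ = 8 + 2j − 2k` (PROP C (a)), H2 ⟺ `n = 4 + ℓ` with
`n = n_Γ` (first hull) resp. `n = n_S` (second hull); members singular at the `j` orbits exist iff `j ≤ k − 1` (THEOREM B (d)). The
solutions are exactly: first hull `(k, j, ℓ) ∈ {(2,1,2), (3,1,0), (3,2,2)}`, second hull `{(2,1,0), (3,1,2), (3,2,2)}`; junk length is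
`0` or `2` (= length `1` at each node of one `ι`-pair, or junk off the on-carrier nodes, dead by [XVIII] THMS 1–3 / LEMMA NF). Recorded:
the enumeration. -/
theorem carrier_node_types (k j : ℕ) (hk : k ≤ 3) (hj : 1 ≤ j) (hmem : j + 1 ≤ k) :
    (∀ ℓ : ℕ, 8 + 2 * j - 2 * k = 4 + ℓ → (k = 2 ∧ j = 1 ∧ ℓ = 2) ∨ (k = 3 ∧ j = 1 ∧ ℓ = 0) ∨ (k = 3 ∧ j = 2 ∧ ℓ = 2)) ∧
    (∀ ℓ : ℕ, 2 * k = 4 + ℓ → (k = 2 ∧ j = 1 ∧ ℓ = 0) ∨ (k = 3 ∧ j = 1 ∧ ℓ = 2) ∨ (k = 3 ∧ j = 2 ∧ ℓ = 2)) := by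
  constructor <;> intro ℓ h <;> omega

/-- PROPOSITION C (c) / THEOREM D (report 3.3–3.5), the FAMILY DIMENSIONS. Base `{n_S ≥ 2k} ⊂ A° × 𝒵` has all components of dimension
`≥ (4 + d′ + k) − 2k = 4 + d′ − k` (finite image of the zero locus `{D_a ≥ f^*B}` of the section `s_a|_{f^*B}` of the rank-`2k` bundle
`H⁰(𝒪_{f^*B}(D_a))` on the incidence `{(a, Z, B) : B ∈ C_k}`, relative over the `d′`-dimensional carrier family; report 3.3); members singular at the `j` orbits: `ℙ^{k−j−1}`; junk of length `1` at each node of an on-carrier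
`ι`-pair: `ℙ^{μ(N)−1}` with `μ(N) ≥ 2` (LEMMA Q). Total `≥ (4 + d′ − k) + (k − j − 1) + [ℓ = 2] = 3 + d′ − j + [ℓ = 2] ≥ 2 + d′ ≥ 3` for
each of the six types and `d′ ∈ {1, 2}` — so [XVIII] THEOREM 4 (a) (junk-free types, flat limits included) and the family mechanism over
the relative Quot scheme (junk types) give `e₁^ι ≥ 2` everywhere: the row (R16-a) is DEAD. Recorded: the six totals. -/
theorem carrier_node_family_dims (d : ℤ) (hd : d = 1 ∨ d = 2) :
    (4 + d - 3) + (3 - 1 - 1) + 0 = 2 + d ∧      -- FH(3,1,0): the ℙ¹-families of junk-free first-hull candidates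
    (4 + d - 2) + (2 - 1 - 1) + 1 = 3 + d ∧      -- FH(2,1,2) and its junk ℙ^{≥1}
    (4 + d - 3) + (3 - 2 - 1) + 1 = 2 + d ∧      -- FH(3,2,2): the doubly nodal member [v_l] with junk at one pair
    (4 + d - 2) + (2 - 1 - 1) + 0 = 2 + d ∧      -- SH(2,1,0) ([XVIII] THM 5 (b))
    (4 + d - 3) + (3 - 1 - 1) + 1 = 3 + d ∧      -- SH(3,1,2)
    (4 + d - 3) + (3 - 2 - 1) + 1 = 2 + d ∧      -- SH(3,2,2)
    (3 : ℤ) ≤ 2 + d := by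
  rcases hd with h | h <;> subst h <;> norm_num

/-- LEMMA Q (report 3.4): at a node `p ∈ Z` of `D` the canonical stalk `N = ker(M_Q → M_Q|_Z^{tf}) = 𝓘_Γ ∩ 𝓘_Z` has
`μ(N) = dim N ⊗ k(p) = μ(M_Q) − 1 + (μ(𝓘_{Z/D}) − r)` from `Tor_1(M_Q, k) → Tor_1(𝒪_Z, k) → N ⊗ k → M_Q ⊗ k → k → 0`, with `μ(M_Q) = 2`,
`μ(𝓘_{Z/D}) = 3` (`Z` smooth of codimension `3` in `A`, `f ∈ 𝔪·𝓘_{Z/A}`) and `r = rank(k² → k³) ≤ 2`: so `2 ≤ μ(N) ≤ 4` and the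
`ι`-symmetric colength-one junk at the pair `±p` moves in `ℙ(N ⊗ k)^∨ ≅ ℙ^{μ(N)−1}`, of dimension `≥ 1`, for EVERY branch (`uniform19.py`
§E: `μ(N) = 2` for all sampled monomial branches, incl. [XVIII] 8.3 (e)'s). Over the `μ`-strata of a base of dimension `≥ 3` the junk
families have dimension `≥ 3 + (μ − 1) ≥ 4` on the generic stratum and `≥ μ′ − 1 ≥ 2` on every jump stratum (`μ′ ≥ μ + 1 ≥ 3`).
Recorded: the bounds. -/
theorem junk_quot_fibre_dims (r b μ' : ℤ) (hr0 : 0 ≤ r) (hr : r ≤ 2) (hb : 3 ≤ b) (hμ' : (2 - 1 + (3 - r)) + 1 ≤ μ') :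
    2 ≤ 2 - 1 + (3 - r) ∧ 2 - 1 + (3 - r) ≤ 4 ∧ 1 ≤ (2 - 1 + (3 - r)) - 1 ∧ 4 ≤ b + ((2 - 1 + (3 - r)) - 1) ∧ 2 ≤ μ' - 1 := by
  refine ⟨by omega, by omega, by omega, by omega, by omega⟩

/-- CENSUS (report §4): after [XIX] the (R16-a) row contributes NOTHING on a general fourfold — of [XVIII]'s residual cells, (c3) is VOID
(`k = 4` excluded), (c1) is VOID (no rank or kernel jump: `ρ ≡ 5 − k`, `dim K ∩ Λ^{(z)} ≡ k − 1`), (c2) is covered (the uniform plane lemma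
holds for non-reduced patterns), '8.3 (e)' is DEAD (LEMMA Q); what is left of the 2Θ-habitat on a general `A` is (R16-b), (R16-d), (R16-f)
and the nest (N16-M) — `4` named rows —, plus (R16-c) on special `A`. Recorded: the count of residual rows before/after
(`{(R16-a), (R16-b), (R16-d), (R16-f), nest} → {(R16-b), (R16-d), (R16-f), nest}`). -/
theorem habitat_residual_rows : (5 : ℕ) - 1 = 4 ∧ (3 : ℕ) + 1 = 4 := by
  exact ⟨rfl, rfl⟩

end H2UniformPlane

section H2UniformPlaneAddendumA

/-!
## ADDENDUM A (report §6): Prym–Brill–Noether non-degeneracy by Debarre–Fahlaoui; the hull numerics on EVERY integral member by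
## Grothendieck duality (no small resolution); the dimensions of the bad-member loci through Abel–Prym carriers ((R16-b) scoping)

LEMMA PBN (6.1): for a double cover `C̃ → C` ramified in two points (`g(C̃) = 2g`, `dim P = g`) the translate `P̃₂(−x̃)` of the Prym
variety cannot lie in `W_{2g−1}(C̃) ⊊ Pic^{2g−1}(C̃)`, because Debarre–Fahlaoui's inequality `dim Z + dim A + 2s ≤ d` for an `A`-stable
`Z ⊂ W^s_d` would give `g + g ≤ 2g − 1`; so [XVII] 2.2's standing hypothesis `P̃₂ ⊄ D₂` holds for EVERY such cover, and [XIX] 2.1 (ram) (c)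
needs neither it nor `NS = ℤθ`. THEOREM A′ (6.2): for every INTEGRAL member `D ⊃ S_a` of `ℙ(Λ_a)` (`a ∉ A[2] ∪ N_tan`; any singularities) the
two hulls `𝓛₂ = 𝓘_{S_a/D}(2Θ)` and `𝓛₁ = 𝓘_{S_a/D}^∨(Θ)` have `v = (0, 2, 2, 2, 2)`: `ch(i_*𝓘_{S_a/D}) = ch(i_*𝒪_D) − ch(i_*𝒪_{S_a}) = (0, 2, −6, 14, −30)`
(Koszul), `𝓘_{S_a/D}` is maximal Cohen–Macaulay (depth lemma), `D` is Gorenstein with `ω_D = 𝒪_D(2Θ)`, and Grothendieck duality for the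
Cartier divisor `D ⊂ A` gives `v_j(i_*(𝓘^∨ ⊗ ω_D)) = (−1)^{j+1} v_j(i_*𝓘) = (0, 2, 6, 14, 30)`; twisting by `e^{−θ}` resp. `e^{2θ}` yields
`(0, 2, 2, 2, 2)` both times — [XVI] THEOREM A's values, with NO small-resolution hypothesis. PROPOSITION E (6.3): in the `ℙ^{k−1}`-bundle of
members through the carrier (dimension `≥ 3 + d′`) the loci 'through a two-torsion point', 'an isolated non-nodal point on `S_a`', 'an
isolated singular point off `S_a`' have all components of dimension `≥ 2 + d′ ≥ 3`: the row (R16-b) with Abel–Prym carriers and isolated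
singularities is never isolated for dimension reasons; what it needs is the sheaf (normal form and flat limits on such members), and the
non-isolated sub-rows are named.
-/

/-- LEMMA PBN (report 6.1), the Debarre–Fahlaoui count: an `A`-stable irreducible `Z ⊂ W^s_d(C)` (`W^s_d ⊊ J^d`) has `dim Z + dim A + 2s ≤ d`
[Debarre–Fahlaoui, Compositio 88 (1993); as quoted in Ciliberto–Mendes Lopes–Pardini, Adv. Math. 257 (2014), Introduction]. For the
translate `Z = P̃₂(−x̃)` of the `g`-dimensional Prym variety of a double cover ramified in two points (`g̃ = 2g`, `d = g̃ − 1 = 2g − 1`,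
`s = 0`, `dim Z = dim A = g`) the inequality would read `2g ≤ 2g − 1`: impossible for every `g ≥ 1` (here `g = 4`: `4 + 4 ≤ 7` is false). So
some `L ∈ P̃₂` has `h⁰(L) = 1`, i.e. `P̃₂ ⊄ D₂`. (Contrast: for an ÉTALE cover `g̃ − 1 = 2 dim P` and `P⁻ ⊂ Θ̃` does occur — the equality case.)
Recorded: the arithmetic. -/
theorem pbn_nondegeneracy_count (g : ℕ) (hg : 1 ≤ g) :
    ¬ (g + g + 2 * 0 ≤ 2 * g - 1) ∧ ¬ ((4 : ℕ) + 4 + 2 * 0 ≤ 7) ∧ (∀ p : ℕ, p + p + 2 * 0 ≤ 2 * p) := by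
  refine ⟨by omega, by omega, fun p => by omega⟩

/-- THEOREM A′ (report 6.2), the hull numerics by duality. In the lineage's `v`-coordinates (`ch(𝒪_A(kΘ)) ↦ (1, k, k², k³, k⁴)`, so that
twisting by `𝒪_A(tΘ)` acts by the binomial convolution `(v·e^{tθ})_j = Σ_i C(j, i) t^{j−i} v_i`): `v(i_*𝒪_D) = (0, 2, −4, 8, −16)`,
`v(i_*𝒪_{S_a}) = (0, 0, 2, −6, 14)`, hence `v(i_*𝓘_{S_a/D}) = (0, 2, −6, 14, −30)`; duality `v_j ↦ (−1)^{j+1} v_j` gives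
`v(i_*(𝓘^∨ ⊗ ω_D)) = (0, 2, 6, 14, 30)`; and `(0, 2, 6, 14, 30)·e^{−θ} = (0, 2, 2, 2, 2) = (0, 2, −6, 14, −30)·e^{2θ}`: both hulls
`𝓛₁ = 𝓘^∨ ⊗ ω_D ⊗ 𝒪(−Θ) = 𝒪_D(Θ + S_a)` and `𝓛₂ = 𝓘(2Θ) = 𝒪_D(2Θ − S_a)` have `v = (0, 2, 2, 2, 2)` on EVERY integral member `D ⊃ S_a` —
[XVI] THEOREM A's values without a small resolution. Recorded: the Koszul differences, the duality signs and the two binomial convolutions,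
component by component. -/
theorem hull_numerics_by_duality :
    -- v(i_* I_{S_a/D}) = v(O_D) - v(O_{S_a})
    ((0 : ℤ) - 0 = 0 ∧ (2 : ℤ) - 0 = 2 ∧ (-4 : ℤ) - 2 = -6 ∧ (8 : ℤ) - (-6) = 14 ∧ (-16 : ℤ) - 14 = -30) ∧
    -- duality: (-1)^{j+1} v_j
    ((-1 : ℤ) ^ (0 + 1) * 0 = 0 ∧ (-1 : ℤ) ^ (1 + 1) * 2 = 2 ∧ (-1 : ℤ) ^ (2 + 1) * (-6) = 6 ∧
      (-1 : ℤ) ^ (3 + 1) * 14 = 14 ∧ (-1 : ℤ) ^ (4 + 1) * (-30) = 30) ∧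
    -- (0,2,6,14,30) · e^{-θ}: Σ_i C(j,i) (-1)^{j-i} w_i = 2 for j = 1..4
    ((1 : ℤ) * 2 = 2 ∧ (2 : ℤ) * 2 * (-1) + 6 = 2 ∧ (3 : ℤ) * 2 + 3 * 6 * (-1) + 14 = 2 ∧
      (4 : ℤ) * 2 * (-1) + 6 * 6 + 4 * 14 * (-1) + 30 = 2) ∧
    -- (0,2,-6,14,-30) · e^{2θ}: Σ_i C(j,i) 2^{j-i} v_i = 2 for j = 1..4
    ((1 : ℤ) * 2 = 2 ∧ (2 : ℤ) * 2 * 2 + (-6) = 2 ∧ (3 : ℤ) * 2 * 4 + 3 * (-6) * 2 + 14 = 2 ∧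
      (4 : ℤ) * 2 * 8 + 6 * (-6) * 4 + 4 * 14 * 2 + (-30) = 2) := by
  norm_num

/-- PROPOSITION E (report 6.3), the bad-member loci through Abel–Prym carriers. In the `ℙ^{k−1}`-bundle `𝔓` of members through the carrier
over `{n_S = 2k}` (every component of dimension `≥ (4 + d′ − k) + (k − 1) = 3 + d′`): 'through a two-torsion point `x ≠ c`' is one linear
condition (codimension `≤ 1`); 'an isolated NON-nodal singular point on `S_a`' is the image of the incidence `{σ_v(x) = 0, det dσ_v(x) = 0}`
(`3` equations on `𝔓 ×_A 𝒮`, relative dimension `2`) with finite general fibres: codimension `≤ 1`; 'an isolated singular point off `S_a`' is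
the image of `{s(x) = 0, ds(x) = 0}` (`5` equations on `𝔓 × A`, relative dimension `4`), finite general fibres: codimension `≤ 1`. Hence each
of these loci has all components of dimension `≥ 2 + d′ ≥ 3` — never `≤ 1`. Recorded: the three counts for `d′ ∈ {1, 2}`, `k ∈ {2, 3}`. -/
theorem bad_member_loci_dims (d k : ℤ) (hd : d = 1 ∨ d = 2) (hk : k = 2 ∨ k = 3) :
    (4 + d - k) + (k - 1) = 3 + d ∧ (3 + d) - 1 = 2 + d ∧ ((3 + d) + 2) - 3 = 2 + d ∧ ((3 + d) + 4) - 5 = 2 + d ∧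
    (3 : ℤ) ≤ 2 + d := by
  rcases hd with h | h <;> rcases hk with h' | h' <;> subst h <;> subst h' <;> norm_num

end H2UniformPlaneAddendumA

section H2UniformPlaneAddendumB

/-!
## ADDENDUM B (report §7): the hulls form FLAT families over ALL members (explicit matrix factorisation); [XVI] PROPOSITION B and [XIX]
## THEOREM D on integral members with arbitrary singularities off the carrier's intersection orbits; (R16-b) reduced to three named sub-rows

THEOREM F (7.1): at a point of `S_a = {u = v = 0}` (`u = θ_a`, `v = θ_{−a}`) every member of `ℙ(Λ_a)` has local equation `f = u·g + v·h`, and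
`φ = [[v, g], [−u, h]]`, `ψ = [[h, −g], [u, v]]` satisfy `φψ = ψφ = f·1`: a matrix factorisation, UNIFORM over the whole family of members; so
`𝓘_{S_a/D} = coker φ` and its dual `𝓘^∨ = Hom(coker φ, 𝒪_D) = ker φ^T = im ψ^T ≅ coker φ^T` have 2-periodic resolutions whose restriction to every member stays exact — both hulls
`𝓛₂ = 𝓘(2Θ)`, `𝓛₁ = 𝓘^∨(Θ)` are FLAT over the entire incidence `{(a, D) : D ∈ ℙ(Λ_a)}` and commute with base change (no equisingularity, no
small resolution). COROLLARY G (7.2): over `𝒞⁺ := {(a, Z, D) : D integral, Z ∩ S_a ∩ Sing D = ∅, n_S = 4}` (OPEN in the incidence; arbitrary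
singularities of `D` off `Z ∩ S_a`, carriers through singular points off `S_a` allowed) the junk-free sheaves `F^± = ker(𝓛 → 𝓛|_Z)` form flat
families of H2-numerical (THEOREM A′) simple `ι`-sheaves with `t ≡ 0` on components of dimension `≥ 3 + d′`: DEAD, unless a whole component
consists of members with infinitely many theta-intersections ((R16-f)′); THEOREM D⁺ (7.3): [XIX] THEOREM D holds with `𝒞^{eq}` replaced by
'`D` integral, ordinary nodes at the orbit(s) on `Z`, no other singular point on `Z ∩ S_a`' (families `≥ 2 + d′`, resp. `≥ 1 + d′ ≥ 2` for the
degenerate-at-`z` sub-locus). RESIDUAL of (R16-b) with Abel–Prym carriers on a general `A` (7.4): (b-i) the carrier through a NON-nodal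
point of `S_a ∩ Sing D`, (b-ii) junk at a non-nodal singular point `∉ A[2]`, (b-iii) non-integral members; plus (R16-f)′, (R16-d), nest;
(R16-c) special `A`.
-/

/-- THEOREM F (report 7.1), the matrix factorisation of a member at a point of `S_a`: with `f = u g + v h`, `φ = [[v, g], [−u, h]]` and
`ψ = [[h, −g], [u, v]]` one has `φ·ψ = ψ·φ = f·1` (entrywise: `v h + g u = f`, `−v g + g v = 0`, `−u h + h u = 0`, `u g + h v = f`, and
symmetrically), and `det φ = v h + u g = f`. The syzygies of `(u, v)` in `𝒪_D = 𝒪_A/(f)` are generated by the Koszul column `(v, −u)` and by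
`(g, h)` (because `a u + b v = c f` in the regular `𝒪_A` forces `(a − c g, b − c h) ∈ 𝒪_A·(v, −u)`), so `𝓘_{S_a/D} = coker φ` with the 2-periodic
resolution `⋯ → 𝒪_D² →ψ 𝒪_D² →φ 𝒪_D² → 𝓘 → 0`, exact on EVERY member (fibrewise `f_b ≠ 0`); hence `𝓘` and `𝓘^∨ ≅ coker φ^T` (the transposed factorisation `(φ^T, ψ^T)`) are
flat over the family of members and commute with base change. Recorded: the eight polynomial identities of `φψ = ψφ = f·1` in a commutative ring. -/
theorem hull_matrix_factorisation {R : Type*} [CommRing R] (u v g h : R) :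
    let f := u * g + v * h
    -- φ ψ = f · 1
    (v * h + g * u = f ∧ v * (-g) + g * v = 0 ∧ (-u) * h + h * u = 0 ∧ (-u) * (-g) + h * v = f) ∧
    -- ψ φ = f · 1
    (h * v + (-g) * (-u) = f ∧ h * g + (-g) * h = 0 ∧ u * v + v * (-u) = 0 ∧ u * g + v * h = f) ∧
    -- det φ = f
    (v * h - g * (-u) = f) := by
  refine ⟨⟨by ring, by ring, by ring, by ring⟩, ⟨by ring, by ring, by ring, by ring⟩, by ring⟩

/-- COROLLARY G / THEOREM D⁺ (report 7.2–7.3), the family dimensions on the enlarged open sets: over `𝒞⁺` (integral members, `Z ∩ S_a ∩ Sing D = ∅`,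
`n_S = 4`) the components have dimension `≥ (4 + d′ − 2) + (2 − 1) = 3 + d′` ([XIX] 3.3 with `k = 2`: the `ℙ¹`-bundle over `{n_S = 4}`), and
losing one parameter to theta-intersection ambiguity still leaves `≥ 2 + d′ ≥ 3`; the carrier-node families of [XIX] 3.3 keep `≥ 2 + d′`, and
their sub-loci 'the node at `z` degenerates' (one equation) keep `≥ 1 + d′ ≥ 2`; a carrier through a singular point OFF `S_a` costs `4`
equations on the `(3 + d′ + 1)`-dimensional incidence with the universal carrier — `≥ d′` — but such configurations already lie in `𝒞⁺`
(the hull is invertible there), so no separate count is needed. Recorded: the arithmetic for `d′ ∈ {1, 2}`. -/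
theorem enlarged_family_dims (d : ℤ) (hd : d = 1 ∨ d = 2) :
    (4 + d - 2) + (2 - 1) = 3 + d ∧ 2 ≤ (3 + d) - 1 ∧ 3 ≤ (3 + d) - 1 ∧ 2 ≤ (2 + d) - 1 ∧ (3 + d + 1) - 4 = d := by
  rcases hd with h | h <;> subst h <;> norm_num

end H2UniformPlaneAddendumB

section H2UniformPlaneAddendumC

/-!
## ADDENDUM C (report §8): the local invariants of the hulls at an ARBITRARY point of the carrier on S_a, LEMMA FL⁺, and THEOREM H —
## every JUNK-FREE configuration of the 2Θ-habitat on an integral member is DEAD; the sub-row (b-i) is closed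

At a point `z ∈ Z ∩ S_a` of a member `f = u g + v h` (THEOREM F) let `o_u, o_v ≥ 1`, `o_g, o_h ≥ 0` be the orders along the branch `Z` (so
`o_u + o_g = o_v + o_h`; `D` is singular at `z` iff `o_g, o_h ≥ 1`). Then (8.1): `n_S(z) = min(o_u, o_v)`; the torsion of `𝓛₁ ⊗ 𝒪_Z` at `z` has
length `e_z = min(o_u, o_v, o_g, o_h)` (Smith form of the rank-one matrix `φ^T(t)`); `(𝓛₂ ⊗ 𝒪_Z)^{tf} = 𝓘·𝒪_Z = 𝒪_Z(−W)` has degree `−n_S`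
exactly; and `(𝓛₁ ⊗ 𝒪_Z)^{tf} ↪ 𝒪_Z(W)(Θ)` has local colength `c_z = min(o_u, o_v) + min(o_u, o_h) − o_u` (the image of `ker φ̄^T = ⟨(u, v), (h, −g)⟩`
in `t^{−n_S(z)} k[[t]]` is `k[[t]] + t^{o_h − o_u} k[[t]]`) — `c_z = 0` iff `D` is smooth at `z`, `c_z = 1` if `e_z = 1`, `c_z ≥ 2` if `e_z ≥ 2`
([XIX] 3.1's `δ_p ≡ 1` is the case '`(u, v, g, h)` are coordinates'). So `χ(T) = 4` reads `n_S − c + ℓ = 4` (first hull, `c = Σ c_z`) resp.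
`n_S = 4 + ℓ` (second hull); junk-free: `(n_S, c) ∈ {(4, 0), (6, 2)}` resp. `n_S = 4` — at most ONE singular orbit on `Z ∩ S_a`, with `e = 1`
for the first hull, of ANY type for the second. LEMMA FL⁺ (8.2): with THEOREM F's flat hulls, [XVIII] LEMMA FL holds on all integral members —
flat limits of canonical sheaves at constant `n = 16 − deg 𝓛|_Z^{tf}` are canonical. THEOREM H (8.3): the junk-free configurations lie on the
OPEN sets `{n_S = 4}`'s `ℙ¹`-bundle (second hull; `n ≡ 4` identically) resp. `𝓕_{3,1}^{e=1}` (first hull; `n ≡ 4`), of dimensions `≥ 3 + d′` resp.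
`≥ 2 + d′`, hence are DEAD by the family mechanism + FL⁺ (effectivity off `Σ_f`) — whatever the singularities of the integral member, on or
off the carrier. Residual of the 2Θ-habitat on a general `A`: (b-ii) junk at a non-nodal singular point `∉ A[2]`, (b-iii) non-integral
members, (R16-f)′, (R16-d), nest (N16-M); (R16-c) special `A`.
-/

/-- ADDENDUM C (report 8.1), the local colength `c_z` and torsion `e_z` at a point of `Z ∩ S_a`: with `o_u + o_g = o_v + o_h`, `o_u, o_v ≥ 1`:
(a) `c_z := min(o_u, o_v) + min(o_u, o_h) − o_u ≥ 0`, and `c_z = 0` iff `o_g = 0 ∨ o_h = 0` (`D` smooth at `z`); (b) if `o_g, o_h ≥ 1` (a singular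
point) then `c_z ≥ 1`, with `c_z = 1` when `e_z = min(o_u, o_v, o_g, o_h) = 1` and `c_z ≥ 2` when `e_z ≥ 2`. Recorded: the four statements, by
exhaustion (`omega`). -/
theorem local_colength_at_carrier_point (ou ov og oh : ℕ) (hu : 1 ≤ ou) (hv : 1 ≤ ov) (hrel : ou + og = ov + oh) :
    ou ≤ min ou ov + min ou oh ∧
    (min ou ov + min ou oh = ou ↔ (og = 0 ∨ oh = 0)) ∧
    (1 ≤ og → 1 ≤ oh → ou + 1 ≤ min ou ov + min ou oh) ∧
    (1 ≤ og → 1 ≤ oh → (ou = 1 ∨ ov = 1 ∨ og = 1 ∨ oh = 1) → min ou ov + min ou oh = ou + 1) ∧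
    (2 ≤ ou → 2 ≤ ov → 2 ≤ og → 2 ≤ oh → ou + 2 ≤ min ou ov + min ou oh) := by
  refine ⟨by omega, by omega, by omega, by omega, by omega⟩

/-- ADDENDUM C (report 8.1–8.3), the junk-free census on integral members: first hull `χ(T) = n_S − c = 4` with `n_S ∈ {0, 2, 4, 6}` (THEOREM A)
and `c = Σ c_z` over the singular ι-orbits on `Z ∩ S_a`, each orbit contributing `2c_z ≥ 2` (`≥ 4` unless `e = 1`): the solutions are `(n_S, c) =
(4, 0)` (no singular point on `Z ∩ S_a`: COR G) and `(6, 2)` (ONE singular orbit with `e = 1`: `𝓕_{3,1}^{e=1}`, ordinary node or not); second hull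
`χ(T) = 8 − n_S = 4`: `n_S = 4`, at most one singular orbit (member-space bound `j ≤ k − 1 = 1`) of ANY type. Family dimensions `≥ 3 + d′` /
`≥ 2 + d′` / `≥ 3 + d′` — all `≥ 3`. Recorded: the enumeration and the bounds for `d′ ∈ {1, 2}`. -/
theorem junk_free_census (nS c : ℕ) (hS : nS = 0 ∨ nS = 2 ∨ nS = 4 ∨ nS = 6) (hc : c = 0 ∨ 2 ≤ c) (h2 : nS = 4 + c) :
    (nS = 4 ∧ c = 0) ∨ (nS = 6 ∧ c = 2) := by
  omega

/-- ADDENDUM C (report 8.3), the dimensions of the families carrying the junk-free configurations: the `ℙ¹`-bundle over `{n_S = 4}`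
(`≥ (4 + d′ − 2) + 1`), the set `𝓕_{3,1}^{e=1}` (`≥ (4 + d′ − 3) + 1 + 1 − 1 = 2 + d′`, recorded as `≥ (4 + d′ − 3) + 1 ≥ 3` for its closure in `𝓕_{3,1}`) and
the degenerate-at-`z` sub-locus (`≥ 2 + d′ − 1 ≥ 2`): room for the family mechanism in every case. Recorded: the arithmetic. -/
theorem junk_free_family_dims (d : ℤ) (hd : d = 1 ∨ d = 2) :
    3 ≤ (4 + d - 2) + 1 ∧ 3 ≤ (4 + d - 3) + 1 ∧ (2 : ℤ) ≤ 2 + d - 1 := by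
  rcases hd with h | h <;> subst h <;> norm_num

end H2UniformPlaneAddendumC

end Summit.HodgeConjecture.HodgeConjecture.WeilTypeLadder
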